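import Literature.NumberTheory.LFunctions.GaussianHeckeClassOne
import Literature.NumberTheory.LFunctions.GaussianHeckeContentMoment
import Literature.NumberTheory.LFunctions.GaussianHeckeMollifier
import Mathlib.Analysis.Complex.ExponentialBounds
import HarnessLib

/-!
# Class-I zeros of the family `L(s, λ^m)`, `m ≤ K`, for the mollified detector

Topic `Literature/NumberTheory/LFunctions`.  Everything in this file is PROVED; no definitions, no named
facts.  This file specialises the abstract class-I count `GaussianHecke.exists_classOne` (hybrid large
sieve for Hecke polynomials) to the Dirichlet polynomial produced by `GaussianHecke.zero_detect`:
a zero `ρ` of `D_m = 4 L(·, λ^m)` is of class I (parameters `X = K`, `x`) when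

  `1 ≤ |∑_{K < n ≤ x} a_X(n) n^{-ρ} (1 - n/x)³|`,  `a_X = c_m ⋆ moebCoeff` (`detCoeff`).

* `classOne_sum_eq` — regrouping by Gaussian integers and then by associates (the summand is invariant
  under units): the sum equals `∑_{w ∈ ℤ[i]*, K < N w ≤ x} 4 μ_X(w) (1 - N w/x)³ λ^m(w) N(w)^{-ρ}`
  (`μ_X = moebTrunc`).
* `sum_shell_eq_sum_dyadic` — the range `K < N w ≤ x` is cut into the dyadic shells
  `K 2^j < N w ≤ K 2^{j+1}`, `j < J = ⌊log₂ x⌋ + 1`, of `exists_classOne`.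
* `exists_classOne_mollified` — pigeonholing a shell with `|block| ≥ 1/J` and applying `exists_classOne`
  shell by shell with `|b_w| ≤ 4 τ⋆(w)` and the content-weighted divisor moment
  `GaussianHecke.sum_content_mul_card_divisorsStar_sq_le`:
  `#Z ≤ C₁ T x^{2-2σ} (1 + log x)^263` for a per-`m` well-spaced family `Z` of class-I zeros with
  `Re ρ ∈ [σ, 1]`, `|Im ρ| ≤ T`, `1/2 ≤ σ ≤ 1`, `1 ≤ K ≤ x`.

## References

* H. L. Montgomery, *Topics in Multiplicative Number Theory*, LNM 227 (1971), Ch. 12. [Montgomery1971]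
-/

noncomputable section

open Finset Complex Real UniqueFactorizationMonoid

namespace Literature.NumberTheory.LFunctions

namespace GaussianHecke

open GaussianInt GaussianTheta

open scoped Classical

/-! ### Units and associates -/

/-- `u ∈ {1, -1, i, -i} ↔ u` is a unit of `ℤ[i]`. [folklore] -/
theorem mem_fourUnits_iff {u : _root_.GaussianInt} :
    u ∈ ({1, -1, ⟨0, 1⟩, ⟨0, -1⟩} : Finset _root_.GaussianInt) ↔ IsUnit u := by
  constructor
  · intro hu
    simp only [mem_insert, mem_singleton] at hu
    refine isUnit_iff_norm_eq_one.mpr ?_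
    rcases hu with rfl | rfl | rfl | rfl <;> decide
  · intro hu
    simp only [mem_insert, mem_singleton]
    exact _root_.Literature.NumberTheory.QuadraticFields.GaussianPrimary.eq_of_isUnit hu

/-- There are four units. [folklore] -/
theorem card_fourUnits : ({1, -1, ⟨0, 1⟩, ⟨0, -1⟩} : Finset _root_.GaussianInt).card = 4 := by decide

/-- **Sum over a norm shell = sum over first-quadrant representatives and units**:
`∑_{a < N z ≤ b} f(z) = ∑_{w ∈ ℤ[i]*, a < N w ≤ b} ∑_{u unit} f(u w)` (`a ≥ 0`). [folklore] -/
theorem sum_normLE_filter_eq_sum_units (f : _root_.GaussianInt → ℂ) {a : ℝ} (b : ℝ) (ha : 0 ≤ a) :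
    ∑ z ∈ (normLE b).filter (fun z : _root_.GaussianInt ↦ a < (z.norm : ℝ)), f z =
      ∑ w ∈ (normLEStar b).filter (fun w : _root_.GaussianInt ↦ a < (w.norm : ℝ)),
        ∑ u ∈ ({1, -1, ⟨0, 1⟩, ⟨0, -1⟩} : Finset _root_.GaussianInt), f (u * w) := by
  set U : Finset _root_.GaussianInt := {1, -1, ⟨0, 1⟩, ⟨0, -1⟩} with hU
  set Sstar := (normLEStar b).filter (fun w : _root_.GaussianInt ↦ a < (w.norm : ℝ)) with hSstar
  have hinj : Set.InjOn (fun p : _root_.GaussianInt × _root_.GaussianInt ↦ p.2 * p.1) ↑(Sstar ×ˢ U) := by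
    rintro ⟨w, u⟩ hp ⟨w', u'⟩ hp' h
    simp only at h
    rw [mem_coe, mem_product] at hp hp'
    obtain ⟨hw, hu⟩ := hp
    obtain ⟨hw', hu'⟩ := hp'
    rw [hSstar, mem_filter, mem_normLEStar] at hw hw'
    obtain ⟨v, rfl⟩ := mem_fourUnits_iff.mp hu
    obtain ⟨v', rfl⟩ := mem_fourUnits_iff.mp hu'
    have hassoc : Associated w w' := by
      refine ⟨v * v'⁻¹, ?_⟩
      calc w * ↑(v * v'⁻¹) = ↑v'⁻¹ * (↑v * w) := by push_cast; ring
        _ = ↑v'⁻¹ * (↑v' * w') := by rw [h]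
        _ = w' := by rw [← mul_assoc, Units.inv_mul, one_mul]
    have hww : w = w' := eq_of_associated hassoc hw.1.2 hw'.1.2
    subst hww
    have hw0 : w ≠ 0 := ne_zero_of_mem_fq hw.1.2
    have : (v : _root_.GaussianInt) = v' := mul_right_cancel₀ hw0 h
    rw [this]
  have himage : (Sstar ×ˢ U).image (fun p : _root_.GaussianInt × _root_.GaussianInt ↦ p.2 * p.1) =
      (normLE b).filter (fun z : _root_.GaussianInt ↦ a < (z.norm : ℝ)) := by
    ext z
    simp only [mem_image, mem_product, mem_filter, mem_normLE, Prod.exists, hSstar, mem_normLEStar]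
    constructor
    · rintro ⟨w, u, ⟨⟨⟨hwb, hwq⟩, hwa⟩, hu⟩, rfl⟩
      have hu' := mem_fourUnits_iff.mp hu
      have hn : (u * w).norm = w.norm := by
        rw [Zsqrtd.norm_mul, isUnit_iff_norm_eq_one.mp hu', one_mul]
      rw [hn]
      exact ⟨hwb, hwa⟩
    · rintro ⟨hzb, hza⟩
      have hz : z ≠ 0 := by
        intro h0
        rw [h0, Zsqrtd.norm_zero, Int.cast_zero] at hza
        linarith
      obtain ⟨v, hv, hq⟩ := exists_q1_eq_mul z
      obtain ⟨w, hw⟩ := hv.exists_left_inv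
      refine ⟨q1 z, w, ⟨⟨⟨?_, q1_mem hz⟩, ?_⟩, mem_fourUnits_iff.mpr (IsUnit.of_mul_eq_one v hw)⟩, ?_⟩
      · rw [norm_q1]; exact hzb
      · rw [norm_q1]; exact hza
      · rw [hq, ← mul_assoc, hw, one_mul]
  rw [← himage, sum_image hinj, sum_product]

/-! ### The class-I sum as a first-quadrant Hecke sum -/

/-- **The class-I Dirichlet polynomial as a Hecke sum over `ℤ[i]*`:**
`∑_{X < n ≤ x} a_X(n) n^{-ρ}(1 - n/x)³ = ∑_{w ∈ ℤ[i]*, X < N w ≤ x} 4 μ_X(w)(1 - N w/x)³ λ^m(w) N(w)^{-ρ}`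
(`X ≥ 0`; `detCoeff_eq_sum`, invariance of `λ^m`, `μ_X`, `N` under units). [folklore] -/
theorem classOne_sum_eq (m : ℕ) {X : ℝ} (hX : 0 ≤ X) (x : ℝ) (ρ : ℂ) :
    ∑ n ∈ Ioc ⌊X⌋₊ ⌊x⌋₊, detCoeff m X n * (n : ℂ) ^ (-ρ) * (1 - (n : ℂ) / x) ^ 3 =
      ∑ w ∈ (normLEStar x).filter (fun w : _root_.GaussianInt ↦ X < (w.norm : ℝ)),
        (4 * (moebTrunc X w : ℂ) * (1 - ((w.norm.natAbs : ℕ) : ℂ) / x) ^ 3) * angularCharZ m w *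
          ((w.norm.natAbs : ℕ) : ℂ) ^ (-ρ) := by
  set F : _root_.GaussianInt → ℂ := fun z ↦ angularChar m z * (moebTrunc X z : ℂ) *
      (((z.norm.natAbs : ℕ) : ℂ) ^ (-ρ) * (1 - ((z.norm.natAbs : ℕ) : ℂ) / x) ^ 3) with hF
  have hmaps : ∀ z ∈ (normLE x).filter (fun z : _root_.GaussianInt ↦ X < (z.norm : ℝ)),
      z.norm.natAbs ∈ Ioc ⌊X⌋₊ ⌊x⌋₊ := by
    intro z hz
    rw [mem_filter, mem_normLE] at hz
    have e : ((z.norm.natAbs : ℕ) : ℝ) = (z.norm : ℝ) := natAbs_norm_real z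
    rw [mem_Ioc]
    exact ⟨(Nat.floor_lt hX).2 (by rw [e]; exact hz.2), Nat.le_floor (by rw [e]; exact hz.1)⟩
  have hstep : ∑ n ∈ Ioc ⌊X⌋₊ ⌊x⌋₊, detCoeff m X n * (n : ℂ) ^ (-ρ) * (1 - (n : ℂ) / x) ^ 3 =
      ∑ z ∈ (normLE x).filter (fun z : _root_.GaussianInt ↦ X < (z.norm : ℝ)), F z := by
    rw [← sum_fiberwise_of_maps_to hmaps]
    refine sum_congr rfl fun n hn ↦ ?_
    rw [mem_Ioc] at hn
    have hn0 : n ≠ 0 := by omega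
    have hfib : ((normLE x).filter (fun z : _root_.GaussianInt ↦ X < (z.norm : ℝ))).filter
        (fun z ↦ z.norm.natAbs = n) = normEq n := by
      ext z
      simp only [mem_filter, mem_normLE, mem_normEq]
      have e : ((z.norm.natAbs : ℕ) : ℝ) = (z.norm : ℝ) := natAbs_norm_real z
      constructor
      · rintro ⟨-, h⟩; rw [← h]; exact (Int.natAbs_of_nonneg (GaussianInt.norm_nonneg z)).symm
      · intro h
        have hnat : z.norm.natAbs = n := by rw [h]; simp
        refine ⟨⟨?_, ?_⟩, hnat⟩
        · rw [← e, hnat]; exact (Nat.le_floor_iff' hn0).1 hn.2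
        · rw [← e, hnat]; exact (Nat.floor_lt hX).1 hn.1
    rw [hfib, detCoeff_eq_sum m X hn0, sum_mul, sum_mul]
    refine sum_congr rfl fun z hz ↦ ?_
    rw [mem_normEq] at hz
    have hnat : z.norm.natAbs = n := by rw [hz]; simp
    simp only [hF, hnat]
    ring
  rw [hstep, sum_normLE_filter_eq_sum_units F x hX]
  refine sum_congr rfl fun w hw ↦ ?_
  rw [mem_filter, mem_normLEStar] at hw
  have hw0 : w ≠ 0 := ne_zero_of_mem_fq hw.1.2
  have hinv : ∀ u ∈ ({1, -1, ⟨0, 1⟩, ⟨0, -1⟩} : Finset _root_.GaussianInt), F (u * w) = F w := by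
    intro u hu
    have hu' := mem_fourUnits_iff.mp hu
    have hn : (u * w).norm = w.norm := by rw [Zsqrtd.norm_mul, isUnit_iff_norm_eq_one.mp hu', one_mul]
    have hassoc : Associated (u * w) w := by
      obtain ⟨v, rfl⟩ := hu'
      exact ⟨v⁻¹, by rw [mul_comm (v : _root_.GaussianInt) w, mul_assoc, Units.mul_inv, mul_one]⟩
    have hmt : moebTrunc X (u * w) = moebTrunc X w := by
      unfold moebTrunc
      rw [divisorsStar_eq_of_associated hassoc (mul_ne_zero hu'.ne_zero hw0)]
    simp only [hF, angularChar_unit_mul m hu', hn, hmt]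
  rw [sum_congr rfl hinv, sum_const, card_fourUnits, nsmul_eq_mul, angularCharZ_natCast]
  simp only [hF]
  push_cast
  ring

/-! ### Dyadic shells -/

/-- **Dyadic decomposition of `K < N w ≤ x`** into the shells `K 2^j < N w ≤ K 2^{j+1}`,
`j < J = ⌊log₂ ⌊x⌋⌋ + 1`, for a summand vanishing when `N w > x` (`1 ≤ K ≤ x`). [folklore] -/
theorem sum_shell_eq_sum_dyadic {K : ℕ} (hK : 1 ≤ K) {x : ℝ} (hKx : (K : ℝ) ≤ x)
    (H : _root_.GaussianInt → ℂ) (hH : ∀ v : _root_.GaussianInt, x < (v.norm : ℝ) → H v = 0) :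
    ∑ v ∈ (normLEStar x).filter (fun v : _root_.GaussianInt ↦ (K : ℝ) < (v.norm : ℝ)), H v =
      ∑ j ∈ range (Nat.log 2 ⌊x⌋₊ + 1),
        ∑ v ∈ (normLEStar (2 * ((K * 2 ^ j : ℕ) : ℝ))).filter (fun v ↦ K * 2 ^ j < v.norm.natAbs), H v := by
  set J := Nat.log 2 ⌊x⌋₊ + 1 with hJ
  set T := (normLEStar x).filter (fun v : _root_.GaussianInt ↦ (K : ℝ) < (v.norm : ℝ)) with hT
  set jOf : _root_.GaussianInt → ℕ := fun v ↦ Nat.log 2 ((v.norm.natAbs - 1) / K) with hjOf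
  have hKpos : 0 < K := hK
  have hx1 : 1 ≤ x := le_trans (by exact_mod_cast hK) hKx
  have h2J : ⌊x⌋₊ < 2 ^ J := Nat.lt_pow_succ_log_self one_lt_two _
  -- for `n > K` and `q = (n-1)/K`, `j = log₂ q`: `K 2^j < n ≤ K 2^{j+1}`
  have hkey : ∀ n : ℕ, K < n →
      K * 2 ^ (Nat.log 2 ((n - 1) / K)) < n ∧ n ≤ K * 2 ^ (Nat.log 2 ((n - 1) / K) + 1) := by
    intro n hn
    obtain ⟨q, hq⟩ : ∃ q, q = (n - 1) / K := ⟨_, rfl⟩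
    rw [← hq]
    have hq1 : 1 ≤ q := by rw [hq]; exact (Nat.le_div_iff_mul_le hKpos).2 (by omega)
    have h1 : 2 ^ Nat.log 2 q ≤ q := Nat.pow_log_le_self 2 (by omega)
    have h2 : q < 2 ^ (Nat.log 2 q + 1) := Nat.lt_pow_succ_log_self one_lt_two q
    have h3 : q * K ≤ n - 1 := by rw [hq]; exact Nat.div_mul_le_self (n - 1) K
    have h4 : n - 1 < K * (q + 1) := by rw [hq]; exact Nat.lt_mul_div_succ (n - 1) hKpos
    have h5 : K * 2 ^ Nat.log 2 q ≤ K * q := Nat.mul_le_mul_left K h1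
    have h6 : K * (q + 1) ≤ K * 2 ^ (Nat.log 2 q + 1) := Nat.mul_le_mul_left K h2
    have h7 : K * q = q * K := mul_comm _ _
    constructor <;> omega
  -- uniqueness of the shell index
  have huniq : ∀ n j : ℕ, K * 2 ^ j < n → n ≤ K * 2 ^ (j + 1) → Nat.log 2 ((n - 1) / K) = j := by
    intro n j h1 h2
    refine Nat.log_eq_of_pow_le_of_lt_pow ?_ ?_
    · rw [Nat.le_div_iff_mul_le hKpos]
      have : 2 ^ j * K = K * 2 ^ j := mul_comm _ _
      omega
    · rw [Nat.div_lt_iff_lt_mul hKpos]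
      have : 2 ^ (j + 1) * K = K * 2 ^ (j + 1) := mul_comm _ _
      omega
  have hmapsT : ∀ v ∈ T, jOf v ∈ range J := by
    intro v hv
    rw [hT, mem_filter, mem_normLEStar] at hv
    have e : ((v.norm.natAbs : ℕ) : ℝ) = (v.norm : ℝ) := natAbs_norm_real v
    have hn : K < v.norm.natAbs := by exact_mod_cast (show (K : ℝ) < v.norm.natAbs by rw [e]; exact hv.2)
    have hnx : v.norm.natAbs ≤ ⌊x⌋₊ := Nat.le_floor (by rw [e]; exact hv.1.1)
    obtain ⟨h1, -⟩ := hkey _ hn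
    rw [mem_range]
    have h3 : 2 ^ jOf v ≤ K * 2 ^ jOf v := Nat.le_mul_of_pos_left _ hKpos
    have h4 : 2 ^ jOf v < 2 ^ J := by simp only [hjOf] at h1 h3 ⊢; omega
    exact (Nat.pow_lt_pow_iff_right (by norm_num)).1 h4
  rw [← sum_fiberwise_of_maps_to hmapsT]
  refine sum_congr rfl fun j _ ↦ ?_
  have epow : ((K * 2 ^ (j + 1) : ℕ) : ℝ) = 2 * ((K * 2 ^ j : ℕ) : ℝ) := by push_cast; ring
  refine sum_subset (fun v hv ↦ ?_) (fun v hv hv' ↦ ?_)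
  · rw [mem_filter] at hv
    obtain ⟨hvT, hvj⟩ := hv
    rw [hT, mem_filter, mem_normLEStar] at hvT
    have e : ((v.norm.natAbs : ℕ) : ℝ) = (v.norm : ℝ) := natAbs_norm_real v
    have hn : K < v.norm.natAbs := by exact_mod_cast (show (K : ℝ) < v.norm.natAbs by rw [e]; exact hvT.2)
    obtain ⟨h1, h2⟩ := hkey _ hn
    have hvj' : Nat.log 2 ((v.norm.natAbs - 1) / K) = j := hvj
    rw [hvj'] at h1 h2
    rw [mem_filter, mem_normLEStar]
    refine ⟨⟨?_, hvT.1.2⟩, h1⟩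
    rw [← e, ← epow]
    exact_mod_cast h2
  · rw [mem_filter, mem_normLEStar] at hv
    obtain ⟨⟨hv2, hvq⟩, hvn⟩ := hv
    have e : ((v.norm.natAbs : ℕ) : ℝ) = (v.norm : ℝ) := natAbs_norm_real v
    have hn2 : v.norm.natAbs ≤ K * 2 ^ (j + 1) := by
      have : ((v.norm.natAbs : ℕ) : ℝ) ≤ ((K * 2 ^ (j + 1) : ℕ) : ℝ) := by rw [e, epow]; exact hv2
      exact_mod_cast this
    have hjv : jOf v = j := huniq _ j hvn hn2
    apply hH
    by_contra hx
    rw [not_lt] at hx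
    apply hv'
    rw [mem_filter, hT, mem_filter, mem_normLEStar]
    refine ⟨⟨⟨hx, hvq⟩, ?_⟩, hjv⟩
    have hKn : K < v.norm.natAbs := lt_of_le_of_lt (Nat.le_mul_of_pos_right K (by positivity)) hvn
    rw [← e]; exact_mod_cast hKn

/-- Pigeonhole: if `V ≤ |∑_{i ∈ s} f i|` and `s ≠ ∅` then `|f i| ≥ V/#s` for some `i ∈ s`. [folklore] -/
theorem exists_div_card_le_norm {ι : Type*} (s : Finset ι) (hs : s.Nonempty) (f : ι → ℂ) {V : ℝ}
    (h : V ≤ ‖∑ i ∈ s, f i‖) : ∃ i ∈ s, V / s.card ≤ ‖f i‖ := by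
  by_contra hc
  push Not at hc
  have hcard : (0 : ℝ) < s.card := by exact_mod_cast hs.card_pos
  have h1 : ‖∑ i ∈ s, f i‖ < V := by
    calc ‖∑ i ∈ s, f i‖ ≤ ∑ i ∈ s, ‖f i‖ := norm_sum_le _ _
      _ < ∑ i ∈ s, V / s.card := sum_lt_sum_of_nonempty hs fun i hi ↦ hc i hi
      _ = V := by rw [sum_const, nsmul_eq_mul]; field_simp
  linarith

/-! ### The shell weight for `|b_w| ≤ 4 τ⋆(w)` -/

/-- On the shell `M < N v ≤ 2M`, for coefficients `|b_v| ≤ 4 τ⋆(v)` and `σ ≥ 0`: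
`∑_v |b_v|² N(v)^{-2σ} g(v) √(2M/N v) ≤ 16 √2 · 12266496 · 2 · M^{1-2σ} (1 + log(2M))^259`. [folklore] -/
theorem shellWeight_le {b : _root_.GaussianInt → ℂ} (hb : ∀ w, ‖b w‖ ≤ 4 * (divisorsStar w).card)
    {M : ℕ} (hM : 1 ≤ M) {σ : ℝ} (hσ : 0 ≤ σ) :
    ∑ v ∈ (normLEStar (2 * M)).filter (fun v ↦ M < v.norm.natAbs),
        ‖b v‖ ^ 2 * ((v.norm.natAbs : ℕ) : ℝ) ^ (-2 * σ) * (content v * Real.sqrt (2 * M / v.norm)) ≤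
      16 * Real.sqrt 2 * 12266496 * 2 * (M : ℝ) ^ (1 - 2 * σ) * (1 + Real.log (2 * M)) ^ 259 := by
  have hM1 : (1 : ℝ) ≤ M := by exact_mod_cast hM
  have hM0 : (0 : ℝ) < M := by linarith
  have h2M : (1 : ℝ) ≤ 2 * M := by linarith
  have hterm : ∀ v ∈ (normLEStar (2 * M)).filter (fun v ↦ M < v.norm.natAbs),
      ‖b v‖ ^ 2 * ((v.norm.natAbs : ℕ) : ℝ) ^ (-2 * σ) * (content v * Real.sqrt (2 * M / v.norm)) ≤
        16 * Real.sqrt 2 * (M : ℝ) ^ (-2 * σ) * ((content v : ℝ) * ((divisorsStar v).card : ℝ) ^ 2) := by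
    intro v hv
    rw [mem_filter, mem_normLEStar] at hv
    obtain ⟨⟨hv2, hvq⟩, hvM⟩ := hv
    have e : ((v.norm.natAbs : ℕ) : ℝ) = (v.norm : ℝ) := natAbs_norm_real v
    have hN1 : (M : ℝ) < (v.norm.natAbs : ℕ) := by exact_mod_cast hvM
    have hN0 : (0 : ℝ) < (v.norm.natAbs : ℕ) := hM0.trans hN1
    -- the three factors
    have h1 : ‖b v‖ ^ 2 ≤ 16 * ((divisorsStar v).card : ℝ) ^ 2 := by
      calc ‖b v‖ ^ 2 ≤ (4 * ((divisorsStar v).card : ℝ)) ^ 2 := pow_le_pow_left₀ (norm_nonneg _) (hb v) 2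
        _ = 16 * ((divisorsStar v).card : ℝ) ^ 2 := by ring
    have h2 : ((v.norm.natAbs : ℕ) : ℝ) ^ (-2 * σ) ≤ (M : ℝ) ^ (-2 * σ) :=
      Real.rpow_le_rpow_of_nonpos hM0 hN1.le (by linarith)
    have h3 : (content v : ℝ) * Real.sqrt (2 * M / v.norm) ≤ (content v : ℝ) * Real.sqrt 2 := by
      refine mul_le_mul_of_nonneg_left (Real.sqrt_le_sqrt ?_) (Nat.cast_nonneg _)
      rw [← e, div_le_iff₀ hN0]
      linarith
    have hc0 : (0 : ℝ) ≤ content v * Real.sqrt (2 * M / v.norm) := by positivity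
    calc ‖b v‖ ^ 2 * ((v.norm.natAbs : ℕ) : ℝ) ^ (-2 * σ) * (content v * Real.sqrt (2 * M / v.norm))
        ≤ (16 * ((divisorsStar v).card : ℝ) ^ 2) * (M : ℝ) ^ (-2 * σ) * ((content v : ℝ) * Real.sqrt 2) :=
          mul_le_mul (mul_le_mul h1 h2 (Real.rpow_nonneg hN0.le _) (by positivity)) h3 hc0 (by positivity)
      _ = 16 * Real.sqrt 2 * (M : ℝ) ^ (-2 * σ) * ((content v : ℝ) * ((divisorsStar v).card : ℝ) ^ 2) := by
          ring
  calc ∑ v ∈ (normLEStar (2 * M)).filter (fun v ↦ M < v.norm.natAbs),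
        ‖b v‖ ^ 2 * ((v.norm.natAbs : ℕ) : ℝ) ^ (-2 * σ) * (content v * Real.sqrt (2 * M / v.norm))
      ≤ ∑ v ∈ (normLEStar (2 * M)).filter (fun v ↦ M < v.norm.natAbs),
          16 * Real.sqrt 2 * (M : ℝ) ^ (-2 * σ) * ((content v : ℝ) * ((divisorsStar v).card : ℝ) ^ 2) :=
        sum_le_sum hterm
    _ = 16 * Real.sqrt 2 * (M : ℝ) ^ (-2 * σ) * ∑ v ∈ (normLEStar (2 * M)).filter (fun v ↦ M < v.norm.natAbs),
          (content v : ℝ) * ((divisorsStar v).card : ℝ) ^ 2 := by rw [mul_sum]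
    _ ≤ 16 * Real.sqrt 2 * (M : ℝ) ^ (-2 * σ) * ∑ v ∈ normLEStar (2 * M),
          (content v : ℝ) * ((divisorsStar v).card : ℝ) ^ 2 := by
        refine mul_le_mul_of_nonneg_left (sum_le_sum_of_subset_of_nonneg (filter_subset _ _)
          (fun v _ _ ↦ by positivity)) (by positivity)
    _ ≤ 16 * Real.sqrt 2 * (M : ℝ) ^ (-2 * σ) * (12266496 * (2 * M) * (1 + Real.log (2 * M)) ^ 259) :=
        mul_le_mul_of_nonneg_left (sum_content_mul_card_divisorsStar_sq_le h2M) (by positivity)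
    _ = 16 * Real.sqrt 2 * 12266496 * 2 * ((M : ℝ) ^ (-2 * σ) * M) * (1 + Real.log (2 * M)) ^ 259 := by ring
    _ = 16 * Real.sqrt 2 * 12266496 * 2 * (M : ℝ) ^ (1 - 2 * σ) * (1 + Real.log (2 * M)) ^ 259 := by
        rw [show (1 : ℝ) - 2 * σ = -2 * σ + 1 by ring, Real.rpow_add hM0, Real.rpow_one]

/-! ### The class-I count -/

/-- **One dyadic block of class-I zeros.**  For coefficients `|b_w| ≤ 4 τ⋆(w)`, `1 ≤ K ≤ M < x`,
`1/2 ≤ σ ≤ 1`, `T ≥ 1`, `V > 0` with `V⁻¹ ≤ A`, `log(4M) ≤ A`, `1 + log(2M) ≤ A`, a per-`m` well-spaced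
family `Zb` of pairs `(m, ρ)` (`1 ≤ m ≤ K`, `Re ρ ∈ [σ,1]`, `|Im ρ| ≤ T`) on which the block `M < N v ≤ 2M`
of the Hecke sum is `≥ V` in modulus has `#Zb ≤ C_b T x^{2-2σ} A^262`. [cite: Montgomery1971, Ch. 12] -/
theorem exists_classOne_block (hMVT : JarviniemiTeravainen2024_heckeMVT) : ∃ C : ℝ, 0 ≤ C ∧
    ∀ (b : _root_.GaussianInt → ℂ), (∀ w, ‖b w‖ ≤ 4 * (divisorsStar w).card) →
    ∀ (K M : ℕ) (x σ T V A : ℝ) (Zb : Finset (ℕ × ℂ)), 1 ≤ K → K ≤ M → (M : ℝ) < x → 1 ≤ T →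
      1 / 2 ≤ σ → σ ≤ 1 → 0 < V → V⁻¹ ≤ A → Real.log (4 * M) ≤ A → 1 + Real.log (2 * M) ≤ A →
      (∀ p ∈ Zb, 1 ≤ p.1 ∧ p.1 ≤ K) → (∀ p ∈ Zb, σ ≤ p.2.re ∧ p.2.re ≤ 1) → (∀ p ∈ Zb, |p.2.im| ≤ T) →
      (∀ p ∈ Zb, ∀ p' ∈ Zb, p.1 = p'.1 → p ≠ p' → 1 ≤ |p.2.im - p'.2.im|) →
      (∀ p ∈ Zb, V ≤ ‖∑ v ∈ (normLEStar (2 * M)).filter (fun v ↦ M < v.norm.natAbs),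
        b v * angularCharZ (p.1 : ℤ) v * ((v.norm.natAbs : ℕ) : ℂ) ^ (-p.2)‖) →
      (Zb.card : ℝ) ≤ C * T * x ^ (2 - 2 * σ) * A ^ 262 := by
  obtain ⟨C₀, hC₀, hone⟩ := exists_classOne hMVT
  refine ⟨2 * C₀ * (16 * Real.sqrt 2 * 12266496 * 2), by positivity, ?_⟩
  intro b hb K M x σ T V A Zb hK hKM hMx hT hσ hσ1 hV hVA h4M h2M hZ1 hZβ hZγ hsep hlarge
  have hM1 : 1 ≤ M := hK.trans hKM
  have hMR : (1 : ℝ) ≤ M := by exact_mod_cast hM1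
  have hM0 : (0 : ℝ) < M := by linarith
  have hMKR : (K : ℝ) ≤ M := by exact_mod_cast hKM
  have hA0 : 0 ≤ A := le_trans (inv_nonneg.2 hV.le) hVA
  set Z' : Finset (ℤ × ℂ) := Zb.image (fun p ↦ ((p.1 : ℤ), p.2)) with hZ'
  have hinjZ : Set.InjOn (fun p : ℕ × ℂ ↦ ((p.1 : ℤ), p.2)) ↑Zb := by
    intro p _ p' _ h
    simp only [Prod.mk.injEq, Nat.cast_inj] at h
    exact Prod.ext h.1 h.2
  have hcardZ' : Z'.card = Zb.card := card_image_of_injOn hinjZ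
  have hmemZ' : ∀ q ∈ Z', ∃ p ∈ Zb, ((p.1 : ℤ), p.2) = q := fun q hq ↦ by
    simpa only [hZ', mem_image] using hq
  have h1 := hone b M K σ T V Z' hM1 hK hT hV
    (fun q hq ↦ by
      obtain ⟨p, hp, rfl⟩ := hmemZ' q hq
      have := hZ1 p hp
      rw [mem_Icc]; dsimp only; constructor <;> omega)
    (fun q hq ↦ by
      obtain ⟨p, hp, rfl⟩ := hmemZ' q hq
      have := hZβ p hp
      dsimp only
      exact ⟨this.1, by linarith [this.2]⟩)
    (fun q hq ↦ by
      obtain ⟨p, hp, rfl⟩ := hmemZ' q hq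
      exact hZγ p hp)
    (fun q hq q' hq' h1 hne ↦ by
      obtain ⟨p, hp, rfl⟩ := hmemZ' q hq
      obtain ⟨p', hp', rfl⟩ := hmemZ' q' hq'
      dsimp only at h1 ⊢
      have hm : p.1 = p'.1 := by exact_mod_cast h1
      have hne' : p ≠ p' := fun h ↦ hne (by rw [h])
      exact hsep p hp p' hp' hm hne')
    (fun q hq ↦ by
      obtain ⟨p, hp, rfl⟩ := hmemZ' q hq
      exact hlarge p hp)
  have hW := shellWeight_le hb hM1 (by linarith : (0 : ℝ) ≤ σ)
  have hMx' : (M : ℝ) ≤ x := hMx.le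
  have hMK2 : (M : ℝ) + K ≤ 2 * M := by linarith
  have hlog4M0 : 0 ≤ Real.log (4 * M) := Real.log_nonneg (by linarith)
  have hlog2M0 : 0 ≤ 1 + Real.log (2 * M) := by
    have : 0 ≤ Real.log (2 * M) := Real.log_nonneg (by linarith)
    linarith
  have hMpow : (M : ℝ) ^ (1 - 2 * σ) * M ≤ x ^ (2 - 2 * σ) := by
    rw [← Real.rpow_add_one hM0.ne', show (1 : ℝ) - 2 * σ + 1 = 2 - 2 * σ by ring]
    exact Real.rpow_le_rpow hM0.le hMx' (by linarith)
  set W : ℝ := ∑ v ∈ (normLEStar (2 * M)).filter (fun v ↦ M < v.norm.natAbs),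
      ‖b v‖ ^ 2 * ((v.norm.natAbs : ℕ) : ℝ) ^ (-2 * σ) * (content v * Real.sqrt (2 * M / v.norm)) with hWdef
  have hc16 : (0 : ℝ) ≤ 16 * Real.sqrt 2 * 12266496 * 2 := by positivity
  have hcM : (0 : ℝ) ≤ 16 * Real.sqrt 2 * 12266496 * 2 * (M : ℝ) ^ (1 - 2 * σ) :=
    mul_nonneg hc16 (Real.rpow_nonneg hM0.le _)
  have hW' : W ≤ 16 * Real.sqrt 2 * 12266496 * 2 * (M : ℝ) ^ (1 - 2 * σ) * A ^ 259 :=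
    hW.trans (mul_le_mul_of_nonneg_left (pow_le_pow_left₀ hlog2M0 h2M 259) hcM)
  have hW0 : 0 ≤ W := sum_nonneg fun v _ ↦ by positivity
  have hVsq : W / V ^ 2 = W * V⁻¹ ^ 2 := by rw [div_eq_mul_inv, inv_pow]
  have hV2 : V⁻¹ ^ 2 ≤ A ^ 2 := pow_le_pow_left₀ (inv_nonneg.2 hV.le) hVA 2
  rw [hcardZ'] at h1
  have ha : ((M : ℝ) + K) * Real.log (4 * M) ≤ (2 * M) * A := mul_le_mul hMK2 h4M hlog4M0 (by positivity)
  have hb' : W * V⁻¹ ^ 2 ≤ (16 * Real.sqrt 2 * 12266496 * 2 * (M : ℝ) ^ (1 - 2 * σ) * A ^ 259) * A ^ 2 :=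
    mul_le_mul hW' hV2 (pow_nonneg (inv_nonneg.2 hV.le) 2) (mul_nonneg hcM (pow_nonneg hA0 _))
  calc (Zb.card : ℝ) ≤ C₀ * ((M : ℝ) + K) * T * Real.log (4 * M) * W / V ^ 2 := h1
    _ = C₀ * T * ((((M : ℝ) + K) * Real.log (4 * M)) * (W * V⁻¹ ^ 2)) := by
        rw [mul_div_assoc, hVsq]; ring
    _ ≤ C₀ * T * (((2 * M) * A) * ((16 * Real.sqrt 2 * 12266496 * 2 * (M : ℝ) ^ (1 - 2 * σ) * A ^ 259) * A ^ 2)) :=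
        mul_le_mul_of_nonneg_left (mul_le_mul ha hb' (mul_nonneg hW0 (pow_nonneg (inv_nonneg.2 hV.le) 2))
          (mul_nonneg (by positivity) hA0)) (mul_nonneg hC₀ (by linarith))
    _ = 2 * C₀ * (16 * Real.sqrt 2 * 12266496 * 2) * T * ((M : ℝ) ^ (1 - 2 * σ) * M) * A ^ 262 := by ring
    _ ≤ 2 * C₀ * (16 * Real.sqrt 2 * 12266496 * 2) * T * x ^ (2 - 2 * σ) * A ^ 262 :=
        mul_le_mul_of_nonneg_right (mul_le_mul_of_nonneg_left hMpow
          (mul_nonneg (mul_nonneg (mul_nonneg (by norm_num) hC₀) hc16) (by linarith))) (pow_nonneg hA0 _)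

/-- **Class-I zeros of the family for the mollified detector** (see the module docstring).
[cite: Montgomery1971, Ch. 12, Thm 12.1 (method)] -/
theorem exists_classOne_mollified (hMVT : JarviniemiTeravainen2024_heckeMVT) : ∃ C₁ : ℝ, 0 ≤ C₁ ∧
    ∀ (K : ℕ) (x σ T : ℝ) (Z : Finset (ℕ × ℂ)), 1 ≤ K → (K : ℝ) ≤ x → 1 ≤ T → 1 / 2 ≤ σ → σ ≤ 1 →
      (∀ p ∈ Z, 1 ≤ p.1 ∧ p.1 ≤ K) → (∀ p ∈ Z, σ ≤ p.2.re ∧ p.2.re ≤ 1) → (∀ p ∈ Z, |p.2.im| ≤ T) →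
      (∀ p ∈ Z, ∀ p' ∈ Z, p.1 = p'.1 → p ≠ p' → 1 ≤ |p.2.im - p'.2.im|) →
      (∀ p ∈ Z, 1 ≤ ‖∑ n ∈ Ioc ⌊(K : ℝ)⌋₊ ⌊x⌋₊,
          detCoeff p.1 K n * (n : ℂ) ^ (-p.2) * (1 - (n : ℂ) / x) ^ 3‖) →
      (Z.card : ℝ) ≤ C₁ * T * x ^ (2 - 2 * σ) * (1 + Real.log x) ^ 263 := by
  obtain ⟨C, hC, hblk⟩ := exists_classOne_block hMVT
  refine ⟨C * 2 ^ 263, by positivity, ?_⟩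
  intro K x σ T Z hK hKx hT hσ hσ1 hZ1 hZβ hZγ hsep hI
  have hK1 : (1 : ℝ) ≤ K := by exact_mod_cast hK
  have hK0 : (0 : ℝ) ≤ K := by linarith
  have hx1 : 1 ≤ x := hK1.trans hKx
  have hx0 : 0 < x := by linarith
  obtain ⟨L, hL⟩ : ∃ L : ℝ, L = 1 + Real.log x := ⟨_, rfl⟩
  rw [← hL]
  have hlogx : 0 ≤ Real.log x := Real.log_nonneg hx1
  have hL1 : 1 ≤ L := by rw [hL]; linarith
  set J : ℕ := Nat.log 2 ⌊x⌋₊ + 1 with hJ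
  have hJ1 : (1 : ℝ) ≤ J := by rw [hJ]; exact_mod_cast Nat.le_add_left 1 _
  have hJ0 : (0 : ℝ) < J := by linarith
  have hJL : (J : ℝ) ≤ 2 * L := by
    have h1 : (2 : ℝ) ^ (Nat.log 2 ⌊x⌋₊) ≤ x := by
      have : 2 ^ Nat.log 2 ⌊x⌋₊ ≤ ⌊x⌋₊ := Nat.pow_log_le_self 2 (Nat.floor_pos.2 hx1).ne'
      calc (2 : ℝ) ^ Nat.log 2 ⌊x⌋₊ = ((2 ^ Nat.log 2 ⌊x⌋₊ : ℕ) : ℝ) := by push_cast; ring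
        _ ≤ ⌊x⌋₊ := by exact_mod_cast this
        _ ≤ x := Nat.floor_le hx0.le
    have h2 : (Nat.log 2 ⌊x⌋₊ : ℝ) * Real.log 2 ≤ Real.log x := by
      rw [← Real.log_pow]; exact Real.log_le_log (by positivity) h1
    have hlog2 : (1 : ℝ) / 2 < Real.log 2 := by linarith [Real.log_two_gt_d9]
    have h0 : (0 : ℝ) ≤ Nat.log 2 ⌊x⌋₊ := Nat.cast_nonneg _
    have h3 : (Nat.log 2 ⌊x⌋₊ : ℝ) ≤ 2 * Real.log x := by nlinarith
    rw [hJ]; push_cast; rw [hL]; linarith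
  obtain ⟨A, hA⟩ : ∃ A : ℝ, A = 2 * L := ⟨_, rfl⟩
  have hA0 : 0 ≤ A := by rw [hA]; linarith
  have hJA : (J : ℝ) ≤ A := by rw [hA]; exact hJL
  have hApow : A ^ 263 = 2 ^ 263 * L ^ 263 := by rw [hA]; exact mul_pow 2 L 263
  -- the coefficients `b`
  set b : _root_.GaussianInt → ℂ := fun w ↦ if (w.norm : ℝ) ≤ x then
      4 * (moebTrunc (K : ℝ) w : ℂ) * (1 - ((w.norm.natAbs : ℕ) : ℂ) / x) ^ 3 else 0 with hb
  have hb_le : ∀ w : _root_.GaussianInt, ‖b w‖ ≤ 4 * (divisorsStar w).card := by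
    intro w
    simp only [hb]
    split_ifs with hw
    · have e : ((w.norm.natAbs : ℕ) : ℝ) = (w.norm : ℝ) := natAbs_norm_real w
      have h0 : (0 : ℝ) ≤ 1 - ((w.norm.natAbs : ℕ) : ℝ) / x := by
        rw [sub_nonneg, div_le_one hx0, e]; exact hw
      have h1 : 1 - ((w.norm.natAbs : ℕ) : ℝ) / x ≤ 1 := by
        have : (0 : ℝ) ≤ ((w.norm.natAbs : ℕ) : ℝ) / x := by positivity
        linarith
      have h3 : ‖(1 : ℂ) - ((w.norm.natAbs : ℕ) : ℂ) / x‖ = 1 - ((w.norm.natAbs : ℕ) : ℝ) / x := by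
        have : (1 : ℂ) - ((w.norm.natAbs : ℕ) : ℂ) / x = ((1 - ((w.norm.natAbs : ℕ) : ℝ) / x : ℝ) : ℂ) := by
          push_cast; ring
        rw [this, Complex.norm_real, Real.norm_of_nonneg h0]
      rw [norm_mul, norm_mul, norm_pow, h3, Complex.norm_intCast]
      have h4 : ‖(4 : ℂ)‖ = 4 := by simp
      rw [h4]
      have hμ : |(moebTrunc (K : ℝ) w : ℝ)| ≤ (divisorsStar w).card := by
        exact_mod_cast abs_moebTrunc_le (K : ℝ) w
      calc 4 * |(moebTrunc (K : ℝ) w : ℝ)| * (1 - ((w.norm.natAbs : ℕ) : ℝ) / x) ^ 3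
          ≤ 4 * (divisorsStar w).card * 1 :=
            mul_le_mul (mul_le_mul_of_nonneg_left hμ (by norm_num)) (pow_le_one₀ h0 h1) (by positivity)
              (by positivity)
        _ = 4 * (divisorsStar w).card := mul_one _
    · simp
  have hb_zero : ∀ w : _root_.GaussianInt, x < (w.norm : ℝ) → b w = 0 := fun w hw ↦ by
    simp only [hb]; rw [if_neg (not_le.2 hw)]
  -- shells and blocks
  set Sh : ℕ → Finset _root_.GaussianInt := fun j ↦
    (normLEStar (2 * ((K * 2 ^ j : ℕ) : ℝ))).filter (fun v ↦ K * 2 ^ j < v.norm.natAbs) with hSh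
  set S : ℕ → ℕ × ℂ → ℂ := fun j p ↦ ∑ v ∈ Sh j, b v * angularCharZ (p.1 : ℤ) v *
      ((v.norm.natAbs : ℕ) : ℂ) ^ (-p.2) with hS
  have hsumS : ∀ p ∈ Z, ∑ n ∈ Ioc ⌊(K : ℝ)⌋₊ ⌊x⌋₊,
      detCoeff p.1 K n * (n : ℂ) ^ (-p.2) * (1 - (n : ℂ) / x) ^ 3 = ∑ j ∈ range J, S j p := by
    intro p _
    rw [classOne_sum_eq p.1 hK0 x p.2]
    have h1 : ∑ w ∈ (normLEStar x).filter (fun w : _root_.GaussianInt ↦ (K : ℝ) < (w.norm : ℝ)),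
        (4 * (moebTrunc (K : ℝ) w : ℂ) * (1 - ((w.norm.natAbs : ℕ) : ℂ) / x) ^ 3) * angularCharZ p.1 w *
          ((w.norm.natAbs : ℕ) : ℂ) ^ (-p.2) =
        ∑ w ∈ (normLEStar x).filter (fun w : _root_.GaussianInt ↦ (K : ℝ) < (w.norm : ℝ)),
          b w * angularCharZ (p.1 : ℤ) w * ((w.norm.natAbs : ℕ) : ℂ) ^ (-p.2) := by
      refine sum_congr rfl fun w hw ↦ ?_
      rw [mem_filter, mem_normLEStar] at hw
      simp only [hb, if_pos hw.1.1]
    rw [h1, sum_shell_eq_sum_dyadic hK hKx _ (fun v hv ↦ by rw [hb_zero v hv, zero_mul, zero_mul])]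
  -- pigeonhole: every `p` has a block `j < J` with `|S j p| ≥ 1/J`
  set Zj : ℕ → Finset (ℕ × ℂ) := fun j ↦ Z.filter (fun p ↦ 1 / (J : ℝ) ≤ ‖S j p‖) with hZj
  have hcover : Z ⊆ (range J).biUnion Zj := by
    intro p hp
    have h1 : (1 : ℝ) ≤ ‖∑ j ∈ range J, S j p‖ := by rw [← hsumS p hp]; exact hI p hp
    obtain ⟨j, hj, hjp⟩ := exists_div_card_le_norm (range J) ⟨0, mem_range.2 (by omega)⟩ (fun j ↦ S j p) h1
    rw [card_range] at hjp
    rw [mem_biUnion]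
    refine ⟨j, hj, ?_⟩
    simp only [hZj, mem_filter]
    exact ⟨hp, hjp⟩
  have hZjsub : ∀ j, ∀ p ∈ Zj j, p ∈ Z ∧ 1 / (J : ℝ) ≤ ‖S j p‖ := fun j p hp ↦ by
    simp only [hZj, mem_filter] at hp; exact hp
  -- the count on one block
  have hblock : ∀ j ∈ range J, ((Zj j).card : ℝ) ≤ C * T * x ^ (2 - 2 * σ) * A ^ 262 := by
    intro j _
    have hrhs0 : 0 ≤ C * T * x ^ (2 - 2 * σ) * A ^ 262 :=
      mul_nonneg (mul_nonneg (mul_nonneg hC (by linarith)) (Real.rpow_nonneg hx0.le _)) (pow_nonneg hA0 262)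
    set M : ℕ := K * 2 ^ j with hM
    have hMK : K ≤ M := by rw [hM]; exact Nat.le_mul_of_pos_right K (by positivity)
    have hM1 : 1 ≤ M := hK.trans hMK
    have hMR : (1 : ℝ) ≤ M := by exact_mod_cast hM1
    by_cases hMx : x ≤ (M : ℝ)
    · -- the block is empty: `b = 0` on the shell
      have hempty : Zj j = ∅ := by
        simp only [hZj, filter_eq_empty_iff]
        intro p _ hle
        have hS0 : S j p = 0 := by
          simp only [hS]
          refine sum_eq_zero fun v hv ↦ ?_
          simp only [hSh, mem_filter, mem_normLEStar] at hv
          have e : ((v.norm.natAbs : ℕ) : ℝ) = (v.norm : ℝ) := natAbs_norm_real v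
          have hvM : (M : ℝ) < (v.norm.natAbs : ℕ) := by exact_mod_cast hv.2
          rw [hb_zero v (by rw [← e]; linarith), zero_mul, zero_mul]
        rw [hS0, norm_zero] at hle
        have : (0 : ℝ) < 1 / J := by positivity
        linarith
      rw [hempty, card_empty, Nat.cast_zero]
      exact hrhs0
    · rw [not_le] at hMx
      have hlog4M : Real.log (4 * M) ≤ A := by
        rw [hA, hL]
        have : Real.log (4 * M) ≤ Real.log (4 * x) := Real.log_le_log (by positivity) (by linarith)
        rw [Real.log_mul (by norm_num) hx0.ne'] at this
        have h4 : Real.log 4 ≤ 2 := by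
          rw [show (4 : ℝ) = 2 ^ 2 by norm_num, Real.log_pow]; push_cast; linarith [Real.log_two_lt_d9]
        linarith
      have hlog2M : 1 + Real.log (2 * M) ≤ A := by
        rw [hA, hL]
        have : Real.log (2 * M) ≤ Real.log (2 * x) := Real.log_le_log (by positivity) (by linarith)
        rw [Real.log_mul (by norm_num) hx0.ne'] at this
        linarith [Real.log_two_lt_d9]
      have hVA : (1 / (J : ℝ))⁻¹ ≤ A := by rw [one_div, inv_inv]; exact hJA
      exact hblk b hb_le K M x σ T (1 / J) A (Zj j) hK hMK hMx hT hσ hσ1 (by positivity) hVA hlog4M hlog2M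
        (fun p hp ↦ hZ1 p (hZjsub j p hp).1) (fun p hp ↦ hZβ p (hZjsub j p hp).1)
        (fun p hp ↦ hZγ p (hZjsub j p hp).1)
        (fun p hp p' hp' h hne ↦ hsep p (hZjsub j p hp).1 p' (hZjsub j p' hp').1 h hne)
        (fun p hp ↦ (hZjsub j p hp).2)
  -- sum over the blocks
  have hrhs0 : 0 ≤ C * T * x ^ (2 - 2 * σ) * A ^ 262 :=
    mul_nonneg (mul_nonneg (mul_nonneg hC (by linarith)) (Real.rpow_nonneg hx0.le _)) (pow_nonneg hA0 262)
  calc (Z.card : ℝ) ≤ (((range J).biUnion Zj).card : ℝ) := by exact_mod_cast card_le_card hcover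
    _ ≤ ((∑ j ∈ range J, (Zj j).card : ℕ) : ℝ) := by exact_mod_cast card_biUnion_le
    _ ≤ ∑ j ∈ range J, C * T * x ^ (2 - 2 * σ) * A ^ 262 := by push_cast; exact sum_le_sum hblock
    _ = J * (C * T * x ^ (2 - 2 * σ) * A ^ 262) := by rw [sum_const, card_range, nsmul_eq_mul]
    _ ≤ A * (C * T * x ^ (2 - 2 * σ) * A ^ 262) := mul_le_mul_of_nonneg_right hJA hrhs0
    _ = C * A ^ 263 * T * x ^ (2 - 2 * σ) := by ring
    _ = C * 2 ^ 263 * T * x ^ (2 - 2 * σ) * L ^ 263 := by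
        rw [hApow, ← mul_assoc C (2 ^ 263) (L ^ 263), mul_right_comm (C * 2 ^ 263) (L ^ 263) T,
          mul_right_comm (C * 2 ^ 263 * T) (L ^ 263) (x ^ (2 - 2 * σ))]

end GaussianHecke

end Literature.NumberTheory.LFunctions
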